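import Mathlib
import Summits.QuantumAdvantage.QuantumAdvantage.Theorems.WalkNoPerfectKFormCore
import Summits.QuantumAdvantage.QuantumAdvantage.Theorems.WalkNoPerfectLinSel
import HarnessLib

set_option linter.dupNamespace false

/-!
# InnerDegreeLawsA (lens 4, g27; part A of 4) — subcubes, LAW C (restriction-robust k-form kill), LAW Q (the quadratic grade linearises on a common independent set)

Blocker `X = AbsorptionDial.NoPerfectPolyOdd` (item 28487); decomp-qadv lens 4 (minimal-counterexample / extremal reduction), g27.  The NODE record
(rung `QuadFormNoPerfectOdd`, residual `QuadLiftOdd`, sub-rung `OneQuadNoPerfectOdd`, floor `linFormFloor`, `x_iff_pieces`) lives in the cell file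
`g27/InnerDegreeDial.lean` and is NOT landed (Prop-definition node pieces); the tree parts are Prop-definition-free and state only unconditional LAWS.
Kernel-checked content:

* §1–§2 **LAW C (`loss_on_kForm_subcube`, restriction-robust structure kill).**  A u-walk strategy (ANY degree, any `n`) whose
  registers, restricted to some subcube `{fill ρ T v : v ∈ {0,1}^m}` (free coordinates `T : Fin m ↪ Fin n`, the others frozen at `ρ`),
  are functions of `≤ k` linear forms `mod p` of the free bits, loses at some point OF THAT SUBCUBE as soon as
  `(n+1)·2p^k·(2p−1)^m < (2p)^m` (`m ≥ C·p·(k log p + log n)` suffices).  The char-two product-span method of g13/g23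
  (`Coset21.CharTwoKill.abstract_even_existsK`) is restriction-robust: outside cuts and frozen bits only shift the constants `κ g`.
  Contrapositive = the lens-4 NORMAL FORM: every perfect strategy is SPREAD (k-form on NO subcube of dimension `m₀(n,k,p) = O(log n)`).
* §3 **LAW Q (`loss_of_quadTests`, first law at the quadratic grade / rung E4).**  Registers that are arbitrary functions of `k` linear
  forms AND ONE quadratic form `u ↦ Σ_{i,i'} M_g i i' u_i u_{i'} + Σ_i b_g i u_i (mod p)` lose whenever the supports of the `M_g` have a
  COMMON independent set of size `m` with `(n+1)·2p^(k+1)·(2p−1)^m < (2p)^m`: on that subcube every quadratic form is linear.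
-/

open Finset
open Summit.QuantumAdvantage.AdviceFreeQNC0

namespace Summit.QuantumAdvantage.QuantumAdvantage.Theorems.InnerDegreeDial

/-! ### §1 Subcubes: free coordinates `T : Fin m ↪ Fin n`, frozen assignment `ρ` -/

section Subcube

variable {n m : ℕ}

/-- the point of the subcube with free part `v`: coordinate `T j` carries `v j`, every other coordinate is frozen at `ρ` -/
def fill (ρ : Fin n → Bool) (T : Fin m ↪ Fin n) (v : Fin m → Bool) (i : Fin n) : Bool :=
  if h : ∃ j, T j = i then v (Fin.find _ h) else ρ i

/-- `fill` at a free coordinate returns the free bit -/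
@[simp] theorem fill_app (ρ : Fin n → Bool) (T : Fin m ↪ Fin n) (v : Fin m → Bool) (j : Fin m) :
    fill ρ T v (T j) = v j := by
  unfold fill
  have h : ∃ j', T j' = T j := ⟨j, rfl⟩
  rw [dif_pos h]
  have hj : T (Fin.find _ h) = T j := Fin.find_spec (p := fun j' => T j' = T j) h
  rw [T.injective hj]

/-- `fill` at a frozen coordinate returns the frozen bit -/
theorem fill_off (ρ : Fin n → Bool) (T : Fin m ↪ Fin n) (v : Fin m → Bool) {i : Fin n} (hi : ∀ j, T j ≠ i) :
    fill ρ T v i = ρ i := by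
  unfold fill
  rw [dif_neg]
  rintro ⟨j, hj⟩
  exact hi j hj

/-- membership in the range of `T` is decidable pointwise; off the range `fill` is frozen -/
theorem fill_of_not_mem (ρ : Fin n → Bool) (T : Fin m ↪ Fin n) (v : Fin m → Bool) {i : Fin n}
    (hi : i ∉ univ.map T) : fill ρ T v i = ρ i := by
  refine fill_off ρ T v fun j hj => hi ?_
  exact mem_map.mpr ⟨j, mem_univ _, hj⟩

/-- splitting a sum over `Fin n` into the free coordinates (reindexed by `T`) and the frozen ones -/
theorem sum_split {β : Type*} [AddCommMonoid β] (T : Fin m ↪ Fin n) (f : Fin n → β) :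
    ∑ i, f i = ∑ j, f (T j) + ∑ i ∈ (univ.map T)ᶜ, f i := by
  rw [← sum_map univ T f, ← sum_compl_add_sum (univ.map T) f, add_comm]

/-- the frozen part of cut `g`'s walk exponent on the subcube -/
def frozenExp (ρ : Fin n → Bool) (T : Fin m ↪ Fin n) (g : ℕ) : ℕ :=
  ∑ i ∈ (univ.map T)ᶜ, if ρ i = true then Coset21.CharTwoKill.ww g i else 0

/-- **the walk exponent on a subcube** = frozen constant + the `{1,2}`-weighted form of the free bits -/
theorem walkExp_fill (ρ : Fin n → Bool) (T : Fin m ↪ Fin n) (v : Fin m → Bool) (g : ℕ) :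
    walkExp (fill ρ T v) g = frozenExp ρ T g + ∑ j, if v j = true then Coset21.CharTwoKill.ww g (T j) else 0 := by
  rw [Coset21.CharTwoKill.walkExp_eq_sum, sum_split T, add_comm]
  unfold frozenExp
  congr 1
  · refine sum_congr rfl fun i hi => ?_
    rw [fill_of_not_mem ρ T v (mem_compl.mp hi)]
  · refine sum_congr rfl fun j _ => ?_
    rw [fill_app]

/-- a linear form `mod p` on a subcube = frozen constant + a linear form of the free bits -/
theorem linForm_fill {p : ℕ} (ρ : Fin n → Bool) (T : Fin m ↪ Fin n) (v : Fin m → Bool) (ℓ : Fin n → ZMod p) :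
    (∑ i, if fill ρ T v i = true then ℓ i else 0)
      = (∑ i ∈ (univ.map T)ᶜ, if ρ i = true then ℓ i else 0) + ∑ j, if v j = true then ℓ (T j) else 0 := by
  rw [sum_split T, add_comm]
  congr 1
  · refine sum_congr rfl fun i hi => ?_
    rw [fill_of_not_mem ρ T v (mem_compl.mp hi)]
  · refine sum_congr rfl fun j _ => ?_
    rw [fill_app]

end Subcube

/-! ### §2 LAW C: a strategy that is `k`-form on a subcube loses on that subcube -/

section LawC

variable {p : ℕ} [Fact p.Prime]

/-- **LAW C (restriction-robust structure kill).**  If on the subcube `fill ρ T ·` every register of `y` is a function `F g` of `k`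
linear forms `mod p` of the free bits, and `(n+1)·2p^k·(2p−1)^m < (2p)^m`, then `y` loses at some point of the subcube — for EVERY
charge `c`, with no degree hypothesis and no hypothesis on `y` off the subcube. -/
theorem loss_on_kForm_subcube (hp5 : 5 ≤ p) {n m k : ℕ}
    (hcount : (n + 1) * (p ^ k * 2) * (2 * p - 1) ^ m < (2 * p) ^ m) (c : ℕ)
    (y : Fin (n + 1) → (Fin n → Bool) → Bool) (ρ : Fin n → Bool) (T : Fin m ↪ Fin n)
    (lam : Fin (n + 1) → Fin k → Fin m → ZMod p) (F : Fin (n + 1) → (Fin k → ZMod p) → Bool)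
    (hy : ∀ g v, y g (fill ρ T v) = F g (fun j => ∑ i, if v i = true then lam g j i else 0)) :
    ∃ v, ringWinU c y (fill ρ T v) = false := by
  classical
  obtain ⟨hK, ω, ζ, hω, hζ⟩ := Coset21.exists_charTwo_roots p hp5
  have hcount' : Fintype.card (Fin (n + 1)) * (p ^ k * 2) * (2 * p - 1) ^ m < (2 * p) ^ m := by
    rw [Fintype.card_fin]; exact hcount
  obtain ⟨v, hv⟩ := Coset21.CharTwoKill.abstract_even_existsK ω ζ hω lam F
    (fun g : Fin (n + 1) => c + g.val + frozenExp ρ T g.val)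
    (fun (g : Fin (n + 1)) (j : Fin m) => Coset21.CharTwoKill.ww g.val (T j)) hp5 hζ
    (fun g j => Coset21.CharTwoKill.ww_mem g.val (T j)) hcount'
  refine ⟨v, ?_⟩
  rw [Bool.eq_false_iff]
  intro hwin
  simp only [ringWinU, decide_eq_true_eq] at hwin
  have hfilter : (univ.filter fun g : Fin (n + 1) =>
        y g (fill ρ T v) = true ∧ (c + g.val + walkExp (fill ρ T v) g.val) % 3 ≠ 0)
      = (univ.filter fun g : Fin (n + 1) =>
        F g (Coset21.CharTwoKill.kForm lam g v) = true ∧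
          ((c + g.val + frozenExp ρ T g.val) +
            Coset21.CharTwoKill.wForm (fun (g' : Fin (n + 1)) (j : Fin m) => Coset21.CharTwoKill.ww g'.val (T j)) g v) % 3 ≠ 0) := by
    refine filter_congr fun g _ => ?_
    rw [hy g v, walkExp_fill]
    unfold Coset21.CharTwoKill.kForm Coset21.CharTwoKill.wForm
    simp only [add_assoc]
  rw [hfilter] at hwin
  omega

/-- non-vacuity of LAW C's count (critic 66v53 asked for the vacuous `∀ m ≥ m₀` corollary to be removed; these are the honest witnesses):
at `p = 5` the hypothesis holds e.g. with `k = 0, m = n = 60` and with `k = 1, m = n = 90` — the threshold dimension is `m₀(n,k,p) =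
⌈(log (2(n+1)) + k·log p) / log (2p/(2p−1))⌉`, about `9.5·ln(n+1) + 15.3·k + 6.6` for `p = 5`. -/
example : (60 + 1) * (5 ^ 0 * 2) * (2 * 5 - 1) ^ 60 < (2 * 5) ^ 60 := by norm_num
example : (90 + 1) * (5 ^ 1 * 2) * (2 * 5 - 1) ^ 90 < (2 * 5) ^ 90 := by norm_num

end LawC

/-! ### §3 LAW Q: registers through `k` linear forms and ONE extra form that linearizes on a subcube (quadratic grade, rung E4) -/

section LawQ

variable {p : ℕ} [Fact p.Prime]

/-- **LAW Q (abstract form).**  Registers `y g u = F g (k linear forms of u) (q g u)` where the extra inner function `q g`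
(a quadratic form, a cubic, …) restricts AFFINELY to the subcube `fill ρ T ·`; then the strategy loses on that subcube once
`(n+1)·2p^(k+1)·(2p−1)^m < (2p)^m`. -/
theorem loss_of_linearizable (hp5 : 5 ≤ p) {n m k : ℕ}
    (hcount : (n + 1) * (p ^ (k + 1) * 2) * (2 * p - 1) ^ m < (2 * p) ^ m) (c : ℕ)
    (y : Fin (n + 1) → (Fin n → Bool) → Bool) (ρ : Fin n → Bool) (T : Fin m ↪ Fin n)
    (lam : Fin (n + 1) → Fin k → Fin n → ZMod p) (q : Fin (n + 1) → (Fin n → Bool) → ZMod p)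
    (F : Fin (n + 1) → (Fin k → ZMod p) → ZMod p → Bool)
    (hy : ∀ g u, y g u = F g (fun j => ∑ i, if u i = true then lam g j i else 0) (q g u))
    (hq : ∀ g, ∃ (C : ZMod p) (β : Fin m → ZMod p), ∀ v, q g (fill ρ T v) = C + ∑ j, if v j = true then β j else 0) :
    ∃ v, ringWinU c y (fill ρ T v) = false := by
  classical
  choose C β hCβ using hq
  -- frozen constants of the `k` linear forms
  let α : Fin (n + 1) → Fin k → ZMod p := fun g j => ∑ i ∈ (univ.map T)ᶜ, if ρ i = true then lam g j i else 0
  -- the `k+1` forms of the free bits: the restricted linear forms, then `β g`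
  let lam' : Fin (n + 1) → Fin (k + 1) → Fin m → ZMod p :=
    fun g => Fin.snoc (α := fun _ => Fin m → ZMod p) (fun j j' => lam g j (T j')) (β g)
  let F' : Fin (n + 1) → (Fin (k + 1) → ZMod p) → Bool :=
    fun g x => F g (fun j => α g j + x (Fin.castSucc j)) (C g + x (Fin.last k))
  refine loss_on_kForm_subcube hp5 hcount c y ρ T lam' F' fun g v => ?_
  rw [hy g (fill ρ T v), hCβ g v]
  show F g _ _ = F g _ _
  congr 1
  · funext j
    rw [linForm_fill]
    simp [lam', α, Fin.snoc_castSucc]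
  · simp [lam', Fin.snoc_last]

variable {n : ℕ}

/-- the value `Σ_{i,i'} M i i' u_i u_{i'} + Σ_i b i u_i (mod p)` of a quadratic polynomial at a Boolean point -/
def quadVal (M : Fin n → Fin n → ZMod p) (b : Fin n → ZMod p) (u : Fin n → Bool) : ZMod p :=
  (∑ i, ∑ i', if u i = true then (if u i' = true then M i i' else 0) else 0) + ∑ i, if u i = true then b i else 0

/-- **independent sets linearize quadratic forms**: if `M` vanishes on `T × T` then on the subcube `fill ρ T ·` the quadratic
polynomial is affine in the free bits. -/
theorem quadVal_fill_affine {m : ℕ} (M : Fin n → Fin n → ZMod p) (b : Fin n → ZMod p) (ρ : Fin n → Bool) (T : Fin m ↪ Fin n)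
    (hT : ∀ j j', M (T j) (T j') = 0) :
    ∃ (C : ZMod p) (β : Fin m → ZMod p), ∀ v, quadVal M b (fill ρ T v) = C + ∑ j, if v j = true then β j else 0 := by
  classical
  -- frozen indicator and the four blocks
  let r : Fin n → ZMod p := fun i => if ρ i = true then 1 else 0
  refine ⟨(∑ i ∈ (univ.map T)ᶜ, ∑ i' ∈ (univ.map T)ᶜ, if ρ i = true then (if ρ i' = true then M i i' else 0) else 0)
            + ∑ i ∈ (univ.map T)ᶜ, if ρ i = true then b i else 0,
          fun j => (∑ i' ∈ (univ.map T)ᶜ, if ρ i' = true then M (T j) i' else 0)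
            + (∑ i ∈ (univ.map T)ᶜ, if ρ i = true then M i (T j) else 0) + b (T j), fun v => ?_⟩
  unfold quadVal
  -- split every sum over `Fin n` into free part (reindexed by `T`) and frozen part
  have hsplit : ∀ f : Fin n → ZMod p, ∑ i, f i = ∑ j, f (T j) + ∑ i ∈ (univ.map T)ᶜ, f i := fun f => sum_split T f
  have hfree : ∀ j, fill ρ T v (T j) = v j := fun j => fill_app ρ T v j
  have hfroz : ∀ i ∈ (univ.map T)ᶜ, fill ρ T v i = ρ i := fun i hi => fill_of_not_mem ρ T v (mem_compl.mp hi)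
  -- outer split of the double sum and of the linear part
  rw [hsplit (fun i => ∑ i', if fill ρ T v i = true then (if fill ρ T v i' = true then M i i' else 0) else 0),
      hsplit (fun i => if fill ρ T v i = true then b i else 0)]
  -- inner splits
  have hin : ∀ i, (∑ i', if fill ρ T v i = true then (if fill ρ T v i' = true then M i i' else 0) else 0)
      = (∑ j', if fill ρ T v i = true then (if v j' = true then M i (T j') else 0) else 0)
        + ∑ i' ∈ (univ.map T)ᶜ, if fill ρ T v i = true then (if ρ i' = true then M i i' else 0) else 0 := by
    intro i
    rw [hsplit]
    congr 1
    · refine sum_congr rfl fun j' _ => ?_; rw [hfree]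
    · refine sum_congr rfl fun i' hi' => ?_; rw [hfroz i' hi']
  simp_rw [hin]
  -- now rewrite the free/frozen indicator values in the outer positions
  have h1 : (∑ j, ((∑ j', if fill ρ T v (T j) = true then (if v j' = true then M (T j) (T j') else 0) else 0)
        + ∑ i' ∈ (univ.map T)ᶜ, if fill ρ T v (T j) = true then (if ρ i' = true then M (T j) i' else 0) else 0))
      = ∑ j, if v j = true then (∑ i' ∈ (univ.map T)ᶜ, if ρ i' = true then M (T j) i' else 0) else 0 := by
    refine sum_congr rfl fun j _ => ?_
    simp only [hfree, hT]
    by_cases hv : v j = true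
    · simp [hv]
    · simp [hv]
  have h2 : (∑ i ∈ (univ.map T)ᶜ, ((∑ j', if fill ρ T v i = true then (if v j' = true then M i (T j') else 0) else 0)
        + ∑ i' ∈ (univ.map T)ᶜ, if fill ρ T v i = true then (if ρ i' = true then M i i' else 0) else 0))
      = (∑ j', if v j' = true then (∑ i ∈ (univ.map T)ᶜ, if ρ i = true then M i (T j') else 0) else 0)
        + ∑ i ∈ (univ.map T)ᶜ, ∑ i' ∈ (univ.map T)ᶜ, if ρ i = true then (if ρ i' = true then M i i' else 0) else 0 := by
    rw [sum_add_distrib]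
    congr 1
    · rw [sum_comm]
      refine sum_congr rfl fun j' _ => ?_
      by_cases hv : v j' = true
      · simp only [hv, if_true]
        refine sum_congr rfl fun i hi => ?_
        rw [hfroz i hi]
      · simp [hv]
    · refine sum_congr rfl fun i hi => ?_
      refine sum_congr rfl fun i' _ => ?_
      rw [hfroz i hi]
  have h3 : (∑ j, if fill ρ T v (T j) = true then b (T j) else 0) = ∑ j, if v j = true then b (T j) else 0 := by
    refine sum_congr rfl fun j _ => ?_; rw [hfree]
  have h4 : (∑ i ∈ (univ.map T)ᶜ, if fill ρ T v i = true then b i else 0)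
      = ∑ i ∈ (univ.map T)ᶜ, if ρ i = true then b i else 0 := by
    refine sum_congr rfl fun i hi => ?_; rw [hfroz i hi]
  rw [h1, h2, h3, h4]
  -- collect the `v`-linear terms
  have hlin : ∀ j, (if v j = true then
        ((∑ i' ∈ (univ.map T)ᶜ, if ρ i' = true then M (T j) i' else 0)
          + (∑ i ∈ (univ.map T)ᶜ, if ρ i = true then M i (T j) else 0) + b (T j)) else 0)
      = (if v j = true then (∑ i' ∈ (univ.map T)ᶜ, if ρ i' = true then M (T j) i' else 0) else 0)
        + (if v j = true then (∑ i ∈ (univ.map T)ᶜ, if ρ i = true then M i (T j) else 0) else 0)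
        + (if v j = true then b (T j) else 0) := by
    intro j; by_cases hv : v j = true <;> simp [hv]
  simp_rw [hlin, sum_add_distrib]
  ring

/-- **LAW Q (quadratic tests with a common independent set, the first law at rung E4).**  If every register is an arbitrary
function of `k` linear forms and one quadratic polynomial `mod p`, and the quadratic parts `M g` ALL vanish on `T × T` for a set
of `m` free coordinates with `(n+1)·2p^(k+1)·(2p−1)^m < (2p)^m`, the strategy is not perfect (it loses on every such subcube). -/
theorem loss_of_quadTests (hp5 : 5 ≤ p) {m k : ℕ}
    (hcount : (n + 1) * (p ^ (k + 1) * 2) * (2 * p - 1) ^ m < (2 * p) ^ m) (c : ℕ)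
    (y : Fin (n + 1) → (Fin n → Bool) → Bool)
    (lam : Fin (n + 1) → Fin k → Fin n → ZMod p) (M : Fin (n + 1) → Fin n → Fin n → ZMod p) (b : Fin (n + 1) → Fin n → ZMod p)
    (F : Fin (n + 1) → (Fin k → ZMod p) → ZMod p → Bool)
    (hy : ∀ g u, y g u = F g (fun j => ∑ i, if u i = true then lam g j i else 0) (quadVal (M g) (b g) u))
    (T : Fin m ↪ Fin n) (hT : ∀ g j j', M g (T j) (T j') = 0) (ρ : Fin n → Bool) :
    ∃ v, ringWinU c y (fill ρ T v) = false :=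
  loss_of_linearizable hp5 hcount c y ρ T lam (fun g => quadVal (M g) (b g)) F hy
    fun g => quadVal_fill_affine (M g) (b g) ρ T (hT g)

end LawQ

end Summit.QuantumAdvantage.QuantumAdvantage.Theorems.InnerDegreeDial
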